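import Summits.Ventures.GridStability.Lyapunov.NE39LossySplitLinesCast
import Summits.Ventures.GridStability.Lyapunov.NE39LossySplitLinesLPDualDataA
import Summits.Ventures.GridStability.Lyapunov.NE39LossySplitLinesLPDualDataB
import Literature.Computation.Certificates.PosSemidefDecide
import HarnessLib

/-!
# «NE39-LOSSY-SPLITU-CEILING» — kernel file 1 of 2: the tables ARE the Gram products (`Z₁₁ = G1G1ᵀ`, `Z₂₁ = HG1ᵀ`), the
# (D1) matrix `HD = W + Wᵀ` is the formula on the tables, and `HD ⪰ 0` (19 × 19 `LDLᵀ`)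

Cell `gridfusion` (39-bus rung, OBSTRUCTION side); seat gridfusion-lit-6 (g10).  Typed accessors of the witness data on
`S = NE39.splitLurieLinesSystem`'s index types and the kernel decisions that make file `NE39LossySplitLinesLPDual.lean`'s cast identities
go through: `Z11_eq` / `Z21_eq` (every entry of the tables `Z11lit` / `Z21tab` equals the Gram sum over `Fin 19`), `X_eq`, `BZ_eq`,
`HD_eq` (the (D1) matrix entrywise from `AQ`, `BLQ` of `NE39LossySplitLinesCast` BY NAME), `HD_ldl`.  Nothing here is a
statement about a grid.
[cite: BoydVandenberghe2004, §5.9.4 (5.97)–(5.98); HornJohnson2013, Thm 7.2.7]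
-/

namespace Summit.Ventures.GridStability.Lyapunov.NE39LossySplitLinesLPDual

open Matrix Literature.Computation.Certificates
open Literature.MathematicalPhysics.PowerSystems.LyapunovFunctionFamily
open Summit.Ventures.GridStability.Models
open Summit.Ventures.GridStability.Lyapunov.NE39LossySplitLines (e1 AQ CQ BLQ)

/-! ### Typed accessors -/

/-- `G1` on the typed state index (rows) × the rank index `Fin 19`. -/
def G1T : Matrix (Fin 10 ⊕ Fin 9) (Fin 19) ℚ := fun i l => G1lit (e1 i) l
/-- `H` on the typed channel index × the rank index. -/
def HT : Matrix ((Fin 10 × Fin 10) ⊕ (Fin 10 × Fin 10)) (Fin 19) ℚ :=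
  fun k l => Sum.elim (fun pq : Fin 10 × Fin 10 => Htab 0 pq.1 pq.2 l) (fun pq => Htab 1 pq.1 pq.2 l) k
/-- `Z₁₁` on the typed state index. -/
def Z11Q : Matrix (Fin 10 ⊕ Fin 9) (Fin 10 ⊕ Fin 9) ℚ := Z11lit.submatrix e1 e1
/-- `Z₂₁` on the typed indices. -/
def Z21Q : Matrix ((Fin 10 × Fin 10) ⊕ (Fin 10 × Fin 10)) (Fin 10 ⊕ Fin 9) ℚ :=
  fun k i => Sum.elim (fun pq : Fin 10 × Fin 10 => Z21tab 0 pq.1 pq.2 (e1 i)) (fun pq => Z21tab 1 pq.1 pq.2 (e1 i)) k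
/-- `Z₂₂ := H·Hᵀ` (NEVER tabulated: only its diagonal enters a dual functional, because `C·B = 0`). -/
def Z22Q : Matrix ((Fin 10 × Fin 10) ⊕ (Fin 10 × Fin 10)) ((Fin 10 × Fin 10) ⊕ (Fin 10 × Fin 10)) ℚ := HT * HTᵀ
/-- `a0` on the typed channel index. -/
def a0K (k : (Fin 10 × Fin 10) ⊕ (Fin 10 × Fin 10)) : ℚ := Sum.elim (fun pq : Fin 10 × Fin 10 => a0Tab 0 pq.1 pq.2) (fun pq => a0Tab 1 pq.1 pq.2) k
/-- `b0` on the typed channel index. -/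
def b0K (k : (Fin 10 × Fin 10) ⊕ (Fin 10 × Fin 10)) : ℚ := Sum.elim (fun pq : Fin 10 × Fin 10 => b0Tab 0 pq.1 pq.2) (fun pq => b0Tab 1 pq.1 pq.2) k
/-- The ordered pair `(p, q)` of a channel (either family). -/
def pairOf (k : (Fin 10 × Fin 10) ⊕ (Fin 10 × Fin 10)) : Fin 10 × Fin 10 := Sum.elim id id k
/-- `X` on the typed state index. -/
def XF (i j : Fin 10 ⊕ Fin 9) : ℚ := Xlit (e1 i) (e1 j)
/-- `BZ` on the typed state index. -/
def BZF (i j : Fin 10 ⊕ Fin 9) : ℚ := BZlit (e1 i) (e1 j)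
/-- `HD` on the typed state index. -/
def HDF (i j : Fin 10 ⊕ Fin 9) : ℚ := HDlit (e1 i) (e1 j)

/-! ### The tables ARE the Gram products / the formulas (kernel, entrywise over `ℚ`) -/

set_option maxHeartbeats 4000000 in
/-- **`Z11lit = G1·G1ᵀ`** entrywise (kernel). -/
theorem Z11_eq : ∀ i j : Fin 19, Z11lit i j = ∑ l : Fin 19, G1lit i l * G1lit j l := by
  decide +kernel

set_option maxHeartbeats 40000000 in
/-- **`Z21tab = H·G1ᵀ`** entrywise, all 200 × 19 entries (kernel). -/
theorem Z21_eq : ∀ (k : (Fin 10 × Fin 10) ⊕ (Fin 10 × Fin 10)) (j : Fin 10 ⊕ Fin 9), Z21Q k j = ∑ l : Fin 19, HT k l * G1T j l := by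
  decide +kernel

set_option maxHeartbeats 4000000 in
/-- **`Xlit = Z₁₁Aᵀ + AZ₁₁`** entrywise (kernel). -/
theorem X_eq : ∀ i j : Fin 10 ⊕ Fin 9, XF i j =
    (∑ l : Fin 10, Z11Q i (Sum.inl l) * AQ j (Sum.inl l) + ∑ l : Fin 9, Z11Q i (Sum.inr l) * AQ j (Sum.inr l))
      + (∑ l : Fin 10, AQ i (Sum.inl l) * Z11Q (Sum.inl l) j + ∑ l : Fin 9, AQ i (Sum.inr l) * Z11Q (Sum.inr l) j) := by
  decide +kernel

set_option maxHeartbeats 40000000 in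
/-- **`BZlit = B·Z₂₁`** entrywise (kernel; `B = BLQ` rational, sum over the 200 channels). -/
theorem BZ_eq : ∀ i j : Fin 10 ⊕ Fin 9, BZF i j =
    (∑ p : Fin 10, ∑ q : Fin 10, BLQ i (Sum.inl (p, q)) * Z21Q (Sum.inl (p, q)) j)
      + (∑ p : Fin 10, ∑ q : Fin 10, BLQ i (Sum.inr (p, q)) * Z21Q (Sum.inr (p, q)) j) := by
  decide +kernel

/-- **`HDlit = (X − 2BZ) + (X − 2BZ)ᵀ`** entrywise (kernel). -/
theorem HD_eq : ∀ i j : Fin 10 ⊕ Fin 9, HDF i j = (XF i j - 2 * BZF i j) + (XF j i - 2 * BZF j i) := by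
  decide +kernel

set_option maxHeartbeats 4000000 in
/-- **(D1) `HD = W + Wᵀ ⪰ 0`** (19 × 19 kernel `LDLᵀ` on the table). -/
theorem HD_ldl : PSD.LDLCert HDlit := by
  decide +kernel

/-! ### The typed matrix identities -/

/-- `Z₁₁ = G1·G1ᵀ` (typed). -/
theorem Z11Q_gram : Z11Q = G1T * G1Tᵀ := by
  ext i j
  rw [Matrix.mul_apply]
  exact Z11_eq (e1 i) (e1 j)

/-- `Z₂₁ = H·G1ᵀ` (typed). -/
theorem Z21Q_gram : Z21Q = HT * G1Tᵀ := by
  ext k j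
  rw [Matrix.mul_apply]
  exact Z21_eq k j

/-- `X = Z₁₁Aᵀ + AZ₁₁` on the typed index (plumbing; `X` as in lit-6's `dualAdjP`). -/
def XQ : Matrix (Fin 10 ⊕ Fin 9) (Fin 10 ⊕ Fin 9) ℚ := Z11Q * AQᵀ + AQ * Z11Q - (2 : ℚ) • (BLQ * Z21Q)

/-- `HQ = X + Xᵀ` (typed formula). -/
def HQ : Matrix (Fin 10 ⊕ Fin 9) (Fin 10 ⊕ Fin 9) ℚ := XQ + XQᵀ

/-- `Z₁₁Aᵀ + AZ₁₁ = Xlit` (typed). -/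
theorem XQ0_eq : Z11Q * AQᵀ + AQ * Z11Q = Xlit.submatrix e1 e1 := by
  ext i j
  rw [Matrix.submatrix_apply, show Xlit (e1 i) (e1 j) = XF i j from rfl, X_eq i j]
  simp only [Matrix.add_apply, Matrix.mul_apply, Matrix.transpose_apply, Fintype.sum_sum_type]

/-- `B·Z₂₁ = BZlit` (typed). -/
theorem BZQ_eq : BLQ * Z21Q = BZlit.submatrix e1 e1 := by
  ext i j
  rw [Matrix.submatrix_apply, show BZlit (e1 i) (e1 j) = BZF i j from rfl, BZ_eq i j]
  simp only [Matrix.mul_apply, Fintype.sum_sum_type, Fintype.sum_prod_type]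

/-- **`HQ = HDlit`** (typed): the (D1) matrix of the witness IS the decided table. -/
theorem HQ_eq : HQ = HDlit.submatrix e1 e1 := by
  ext i j
  rw [HQ, XQ, XQ0_eq, BZQ_eq, Matrix.submatrix_apply, show HDlit (e1 i) (e1 j) = HDF i j from rfl, HD_eq i j]
  simp only [Matrix.add_apply, Matrix.sub_apply, Matrix.transpose_apply, Matrix.smul_apply, Matrix.submatrix_apply,
    smul_eq_mul, XF, BZF]

end Summit.Ventures.GridStability.Lyapunov.NE39LossySplitLinesLPDual
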